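import Literature.MathematicalPhysics.QuantumLattice.HubbardOpenBoxGeneralPairListOracle
import HarnessLib

/-!
# A word-parallel Jordan–Wigner sign for the coded cluster oracles (xor-folding parity)

Topic `MathematicalPhysics/QuantumLattice`, family `hubbard`. In the coded application of a hopping word
(`hopApplyPar`, `HubbardOpenBoxEDCertificateKronecker`) the fermionic sign is the parity of
`bitCount u p + bitCount u q`, and `bitCount` is a bit-by-bit recursion — the dominant kernel cost of every data-free
certificate and of every exact Rayleigh trace (`HubbardOpenBoxCodedRayleigh`) on clusters with many orbitals. This file
replaces it by the classical word-parallel parity (Lin–Gubernatis 1993 §II: the sign is the parity of the occupied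
orbitals between the two positions, read from the bit code with mask-and-count): `parity64 x` folds `x` onto itself with
`xor`/`shiftRight` six times and reads bit 0, and `jwSignPar u p q = parity64 ((u mod 2^p) xor (u mod 2^q))`.

* §1 `bitPar` (Boolean parity of the bits below a position), `bitCount_mod_two`, `bitPar_xor`, `bitPar_add`,
  `bitPar_mod_two_pow`, **`parity64_eq`**, **`jwSignPar_eq`** (`= (bitCount u p + bitCount u q) % 2` for `p, q ≤ 64`).
* §2 the fast hopping word `hopApplyParF` (`= hopApplyPar` for orbital ranks `≤ 64`), the fast hop-list sum
  `hopListSumWF` (`= hopListSumW` on lists with ranks `≤ 64`, kernel check `orbsLe64`), and the oracles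
  **`listClusterF`** (general pair, precomputed hop list, fast sign) and **`bondClusterF`** (pure hopping classes: no
  diagonal loop at all) with **`listClusterF_models`** / **`bondClusterF_models`** — drop-in replacements for
  `listCluster` in `KCert.checkG` / `CoefTree.sApp`.

Everything is proved; no named fact; nothing numerical is asserted here.

## References

* H. Q. Lin, J. E. Gubernatis, Comput. Phys. 7 (1993) 400, §II (fermion sign from the bit code). [cite: LinGubernatis1993, §II]
* R. Valentí, J. Stolze, P. J. Hirschfeld, Phys. Rev. B 43 (1991) 13743, §II. [cite: ValentiStolzeHirschfeld1991, §II]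
-/

noncomputable section

namespace Literature.MathematicalPhysics.QuantumLattice

namespace OccupationCode

open Finset Matrix ClusterLowerBound

/-! ### §1 Bit parities -/

/-- **Boolean parity of the bits of `x` below position `n`.** [cite: LinGubernatis1993, §II] -/
def bitPar (x : ℕ) : ℕ → Bool
  | 0 => false
  | n + 1 => (bitPar x n) ^^ x.testBit n

/-- `bitCount m k` mod 2 is the bit parity. [cite: LinGubernatis1993, §II] -/
theorem bitCount_mod_two (m : ℕ) : ∀ k, bitCount m k % 2 = (bitPar m k).toNat
  | 0 => by simp [bitCount, bitPar]
  | k + 1 => by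
      rw [bitCount, bitPar, Nat.add_mod, bitCount_mod_two m k]
      cases bitPar m k <;> cases m.testBit k <;> simp

/-- Parity is additive under `xor`. [cite: LinGubernatis1993, §II] -/
theorem bitPar_xor (x y : ℕ) : ∀ n, bitPar (x ^^^ y) n = ((bitPar x n) ^^ (bitPar y n))
  | 0 => by simp [bitPar]
  | n + 1 => by
      rw [bitPar, bitPar, bitPar, bitPar_xor x y n, Nat.testBit_xor]
      cases bitPar x n <;> cases bitPar y n <;> cases x.testBit n <;> cases y.testBit n <;> rfl

/-- Splitting a window: the parity below `s + t` is the parity below `s` xor the parity of the next `t` bits.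
[cite: LinGubernatis1993, §II] -/
theorem bitPar_add (x s : ℕ) : ∀ t, bitPar x (s + t) = ((bitPar x s) ^^ (bitPar (x >>> s) t))
  | 0 => by simp [bitPar]
  | t + 1 => by
      rw [Nat.add_succ, bitPar, bitPar, bitPar_add x s t, Nat.testBit_shiftRight]
      cases bitPar x s <;> cases bitPar (x >>> s) t <;> cases x.testBit (s + t) <;> rfl

/-- **One xor-fold halves the window**: `bitPar (x xor (x >>> s)) s = bitPar x (2s)`. [cite: LinGubernatis1993, §II] -/
theorem bitPar_fold (x s : ℕ) : bitPar (x ^^^ (x >>> s)) s = bitPar x (s + s) := by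
  rw [bitPar_xor, bitPar_add]

/-- Parity of a truncation. [cite: LinGubernatis1993, §II] -/
theorem bitPar_mod_two_pow (x p : ℕ) : ∀ n, bitPar (x % 2 ^ p) n = bitPar x (min p n)
  | 0 => by simp [bitPar]
  | n + 1 => by
      rw [bitPar, bitPar_mod_two_pow x p n, Nat.testBit_mod_two_pow]
      by_cases h : n < p
      · rw [min_eq_right (by omega : n + 1 ≤ p), min_eq_right h.le, bitPar, decide_eq_true h, Bool.true_and]
      · rw [min_eq_left (by omega : p ≤ n + 1), min_eq_left (by omega : p ≤ n), decide_eq_false h, Bool.false_and,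
          Bool.xor_false]

/-- One xor-fold step. [cite: LinGubernatis1993, §II] -/
def xfold (x s : ℕ) : ℕ := x ^^^ (x >>> s)

/-- **Word-parallel parity of the low 64 bits**: six xor-folds (32, 16, 8, 4, 2, 1) and bit 0.
[cite: LinGubernatis1993, §II] -/
def parity64 (x : ℕ) : ℕ := xfold (xfold (xfold (xfold (xfold (xfold x 32) 16) 8) 4) 2) 1 &&& 1

/-- Bit 0 as a number. [folklore] -/
private theorem land_one_eq_toNat (y : ℕ) : y &&& 1 = (bitPar y 1).toNat := by
  rw [Nat.and_one_is_mod, bitPar, bitPar, Bool.false_xor, Nat.testBit_zero]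
  rcases Nat.mod_two_eq_zero_or_one y with h | h <;> simp [h]

/-- **`parity64 x` is the parity of the low 64 bits of `x`.** [cite: LinGubernatis1993, §II] -/
theorem parity64_eq (x : ℕ) : parity64 x = (bitPar x 64).toNat := by
  rw [parity64, land_one_eq_toNat, xfold, bitPar_fold, xfold, bitPar_fold, xfold, bitPar_fold, xfold, bitPar_fold, xfold,
    bitPar_fold, xfold, bitPar_fold]

/-- **The Jordan–Wigner sign parity, word-parallel**: `parity64 ((u mod 2^p) xor (u mod 2^q))`. [cite: LinGubernatis1993, §II] -/
def jwSignPar (u p q : ℕ) : ℕ := parity64 ((u % 2 ^ p) ^^^ (u % 2 ^ q))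

/-- **`jwSignPar u p q = (bitCount u p + bitCount u q) % 2`** for orbital ranks `p, q ≤ 64`. [cite: LinGubernatis1993, §II] -/
theorem jwSignPar_eq (u : ℕ) {p q : ℕ} (hp : p ≤ 64) (hq : q ≤ 64) :
    jwSignPar u p q = (bitCount u p + bitCount u q) % 2 := by
  rw [jwSignPar, parity64_eq, bitPar_xor, bitPar_mod_two_pow, bitPar_mod_two_pow, min_eq_left hp, min_eq_left hq,
    Nat.add_mod, bitCount_mod_two, bitCount_mod_two]
  cases bitPar u p <;> cases bitPar u q <;> rfl

/-! ### §2 Fast hopping words, hop-list sums and oracles -/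

/-- **Coded hopping word with the word-parallel sign** (`= hopApplyPar` for ranks `≤ 64`). [cite: LinGubernatis1993, §II] -/
def hopApplyParF (p q m : ℕ) (f : ℕ → ℤ) : ℤ :=
  if m.testBit p = true ∧ (m - 2 ^ p).testBit q = false then
    (if jwSignPar (m - 2 ^ p) p q = 0 then f (m - 2 ^ p + 2 ^ q) else -f (m - 2 ^ p + 2 ^ q)) else 0

/-- `hopApplyParF = hopApplyPar` on ranks `≤ 64`. [cite: LinGubernatis1993, §II] -/
theorem hopApplyParF_eq {p q : ℕ} (hp : p ≤ 64) (hq : q ≤ 64) (m : ℕ) (f : ℕ → ℤ) :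
    hopApplyParF p q m f = hopApplyPar p q m f := by
  unfold hopApplyParF hopApplyPar
  rw [jwSignPar_eq _ hp hq]

/-- The fast hop-list sum. [cite: LinGubernatis1993, §II] -/
def hopListSumWF (m : ℕ) (f : ℕ → ℤ) : List (ℕ × ℕ × ℤ) → ℤ
  | [] => 0
  | pqw :: rest => pqw.2.2 * hopApplyParF pqw.1 pqw.2.1 m f + hopListSumWF m f rest

/-- Kernel check: every orbital rank of the hop list is `≤ 64`. [folklore] -/
def orbsLe64 (l : List (ℕ × ℕ × ℤ)) : Bool := l.all fun pqw => decide (pqw.1 ≤ 64) && decide (pqw.2.1 ≤ 64)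

/-- `hopListSumWF = hopListSumW` on checked lists. [cite: LinGubernatis1993, §II] -/
theorem hopListSumWF_eq (m : ℕ) (f : ℕ → ℤ) : ∀ l : List (ℕ × ℕ × ℤ), orbsLe64 l = true →
    hopListSumWF m f l = hopListSumW m f l
  | [], _ => rfl
  | pqw :: rest, h => by
      simp only [orbsLe64, List.all_cons, Bool.and_eq_true, decide_eq_true_eq] at h
      rw [hopListSumWF, hopListSumW, hopApplyParF_eq h.1.1 h.1.2, hopListSumWF_eq m f rest (by simpa [orbsLe64] using h.2)]

/-- **THE FAST GENERAL-PAIR ORACLE WITH A PRECOMPUTED HOP LIST** (word-parallel sign). [cite: LinGubernatis1993, §II] -/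
def listClusterF (N : ℕ) (orbs : List (ℕ × ℕ × ℤ)) (V M : ℕ → ℤ) (bound : ℕ) : CodedCluster where
  app m f := -hopListSumWF m f orbs + (doccOfW V N m + densOfW M N m) * f m
  bound := bound

/-- **THE FAST PURE-HOPPING ORACLE** (no repulsion, no potential: no diagonal loop). [cite: LinGubernatis1993, §II] -/
def bondClusterF (orbs : List (ℕ × ℕ × ℤ)) (bound : ℕ) : CodedCluster where
  app m f := -hopListSumWF m f orbs
  bound := bound

/-- A weighted double occupancy with zero weights vanishes. [folklore] -/
private theorem doccOfW_zero (N m : ℕ) : doccOfW (fun _ => 0) N m = 0 := by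
  unfold doccOfW
  induction N with
  | zero => rfl
  | succ N ih => rw [sumNat, ih]; split_ifs <;> rfl

/-- A weighted particle number with zero weights vanishes. [folklore] -/
private theorem densOfW_zero (N m : ℕ) : densOfW (fun _ => 0) N m = 0 := by
  unfold densOfW
  induction N with
  | zero => rfl
  | succ N ih => rw [sumNat, ih]; split_ifs <;> rfl

section Box

variable {a b : ℕ}

/-- **SEMANTICS OF THE FAST HOP-LIST ORACLE** (as `listCluster_models`, plus the rank check `orbsLe64 orbs`).
[cite: LinGubernatis1993, §II] [cite: ValentiStolzeHirschfeld1991, §II] -/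
theorem listClusterF_models (W : ℕ → ℕ → ℤ) (hW : ∀ P Q, W P Q = W Q P) (adj : ℕ → ℕ → Bool)
    (hoff : ∀ P Q, adj P Q = false → W P Q = 0) (hdiag : ∀ P, W P P = 0) (V M : ℕ → ℤ) (Q : ℕ)
    {orbs : List (ℕ × ℕ × ℤ)} (horbs : hopOrbsW W adj (a * b) = orbs) (hle : orbsLe64 orbs = true) :
    (listClusterF (a * b) orbs V M (hzBoundW (a * b) W V M)).Models a b (hzIntGP a b W V M) Q
      (hubbardOpenBoxGP a b (fun x y => (W (siteRank x) (siteRank y) : ℝ) / Q) (fun x => (V (siteRank x) : ℝ) / Q)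
        (fun x => (M (siteRank x) : ℝ) / Q)) where
  apply_eq := (listCluster_models W hW adj hoff hdiag V M Q horbs).apply_eq
  mulVec_eq f s := by
    rw [(listCluster_models (a := a) (b := b) W hW adj hoff hdiag V M Q horbs).mulVec_eq f s]
    have happ : (listCluster (a * b) orbs V M (hzBoundW (a * b) W V M)).app (code s) f =
        (listClusterF (a * b) orbs V M (hzBoundW (a * b) W V M)).app (code s) f := by
      show -hopListSumW (code s) f orbs + (doccOfW V (a * b) (code s) + densOfW M (a * b) (code s)) * f (code s) =
        -hopListSumWF (code s) f orbs + (doccOfW V (a * b) (code s) + densOfW M (a * b) (code s)) * f (code s)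
      rw [hopListSumWF_eq _ _ _ hle]
    rw [happ]
  preserves := (listCluster_models W hW adj hoff hdiag V M Q horbs).preserves
  symm := (listCluster_models W hW adj hoff hdiag V M Q horbs).symm
  abs_le := (listCluster_models (a := a) (b := b) W hW adj hoff hdiag V M Q horbs).abs_le

/-- **SEMANTICS OF THE FAST PURE-HOPPING ORACLE**: with zero repulsion and potential tables, `bondClusterF orbs (hzBoundW …)`
models `h^G(W/Q, 0, 0)`. [cite: LinGubernatis1993, §II] [cite: ValentiStolzeHirschfeld1991, §II] -/
theorem bondClusterF_models (W : ℕ → ℕ → ℤ) (hW : ∀ P Q, W P Q = W Q P) (adj : ℕ → ℕ → Bool)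
    (hoff : ∀ P Q, adj P Q = false → W P Q = 0) (hdiag : ∀ P, W P P = 0) (Q : ℕ)
    {orbs : List (ℕ × ℕ × ℤ)} (horbs : hopOrbsW W adj (a * b) = orbs) (hle : orbsLe64 orbs = true) :
    (bondClusterF orbs (hzBoundW (a * b) W (fun _ => 0) (fun _ => 0))).Models a b (hzIntGP a b W (fun _ => 0) (fun _ => 0)) Q
      (hubbardOpenBoxGP a b (fun x y => (W (siteRank x) (siteRank y) : ℝ) / Q) (fun _ => ((0 : ℤ) : ℝ) / Q)
        (fun _ => ((0 : ℤ) : ℝ) / Q)) where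
  apply_eq := (listClusterF_models W hW adj hoff hdiag (fun _ => 0) (fun _ => 0) Q horbs hle).apply_eq
  mulVec_eq f s := by
    rw [(listClusterF_models (a := a) (b := b) W hW adj hoff hdiag (fun _ => 0) (fun _ => 0) Q horbs hle).mulVec_eq f s]
    have happ : (listClusterF (a * b) orbs (fun _ => 0) (fun _ => 0) (hzBoundW (a * b) W (fun _ => 0) (fun _ => 0))).app
        (code s) f = (bondClusterF orbs (hzBoundW (a * b) W (fun _ => 0) (fun _ => 0))).app (code s) f := by
      show -hopListSumWF (code s) f orbs + (doccOfW (fun _ => 0) (a * b) (code s) + densOfW (fun _ => 0) (a * b) (code s)) *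
          f (code s) = -hopListSumWF (code s) f orbs
      rw [doccOfW_zero, densOfW_zero]; ring
    rw [happ]
  preserves := (listClusterF_models W hW adj hoff hdiag (fun _ => 0) (fun _ => 0) Q horbs hle).preserves
  symm := (listClusterF_models W hW adj hoff hdiag (fun _ => 0) (fun _ => 0) Q horbs hle).symm
  abs_le := (listClusterF_models (a := a) (b := b) W hW adj hoff hdiag (fun _ => 0) (fun _ => 0) Q horbs hle).abs_le

end Box

end OccupationCode

end Literature.MathematicalPhysics.QuantumLattice

end
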